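import Summits.CriticalPhenomena.PercolationContinuityZ3.Theorems.PercNearOneGluingNoHeavyQuantConvPieceBudget
import HarnessLib

/-!
# QUANT lane R8, T-DEC: CONVOLUTION CLOSURE AT THE FAR-DOMINANT LAYERS `4j < 2T₂ + T₁` — NO HEAVINESS NEEDED.
# For two top-affordable laws DEC at every layer (ANY data, light credit pairs on both sides), the convolution satisfies the far row at every
# layer `j` with `4j < 2T₂ + T₁` or `4j < 2T₁ + T₂` — three quarters of the dominant range `2j < T₁ + T₂` — by a GLOBAL (not piece-wise) budget

builds on p205010 (kernel theorem, internal audit signed; external expert review pending)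

Support file (`--supports stmt-CriticalPhenomena-4575`), QUANT lane seat prim-quant-arm-2 (gen 34), rung R8 of
`run/shared/lean/prim/quant/LADDER.md`.  Theorems only (no definitions), standard axioms, no sorries.  Part 2 of 2: part 1 `…QuantConvPieceBudget` has the per-component budget
`piece_budget` and `deepLows_le_giants_pred`; `…QuantConvDominant` has the one-heavy-factor theorem `lconv_tail_ge_of_hdecAtT`.

WHAT.  `lconv_tail_ge_of_hdecAtT` needs a HEAVY datum of one factor at the layer `j`; the light credit pairs `{lo, hi; g < y}` of `μ₂` are worth
only `g + τ·(y−g)/y ≥ g` standalone (`τ = μ₁{> j−lo}`).  Here they are paid GLOBALLY: every valid component `{lo, hi; g}` of `μ₂`'s datum at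
layer `j` satisfies **`W − y ≥ (1−y)·up − y·dl`** (`piece_budget`), where `up` is the component's mass above `j` and `dl` its mass at the DEEP atoms
`h ≤ j`, `h + j < T₂` — and `deepLows_le_giants` for `μ₂` at the layer `j` says exactly `y·μ₂{deep} ≤ (1−y)·μ₂{> j}` (`deepLows_le_giants_pred`),
so the budget closes on summing over the datum.  The regime `4j < 2T₂ + T₁` is what makes a NON-deep low `lo ≥ T₂ − j` of `μ₂` harmless: then
`2(j − lo) ≤ 2(2j − T₂) < T₁`, the layer `j − lo` is dominant for `μ₁` and `τ ≥ y`, so even a light pair on it is worth `≥ y`.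
THEOREMS: **`lconv_tail_ge_farDominant`** (`4j < 2T₂ + T₁`), its mirror, and **`lconv_decAt_farDominant`**: two top-affordable probability laws DEC at
every layer below their tops have a convolution that is DEC at every layer `j` with `4j < 2T₂ + T₁ ∨ 4j < 2T₁ + T₂`.  What remains of the dominant
range is the band `T₁ + T₂ − min(T₁,T₂)/2 ≤ 2j < T₁ + T₂` with light pairs NEEDED on a side (exact census: true with margin ≥ 0.13; not proved).
HONEST STATUS: partial (far-dominant layers); `ConvClosedT`, `SDECConvClosed`, `SingleGateConvClosed`, `TreeDEC`, `FarTreeRow` OPEN; the RATE class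
log\* and the honest sentence of `run/shared/lean/prim/quant/README.md` are unchanged.

* **`LawDec.lconv_tail_ge_farDominant`**, `LawDec.lconv_decAt_farDominant_right`, **`LawDec.lconv_decAt_farDominant`**.

[this work]; DEC rules ARCH-TREES-G49 §2.2 / DEC-TAMP-G50 §3.1, §3.3 (this lane).  Nothing here is cited as a published result.  The gluing rows
served [cite: KozmaNitzan2024, Conjecture 3 (p. 15)]; product measure [cite: Grimmett1999, §1.3 p. 10].
-/

noncomputable section

namespace Summit.CriticalPhenomena.PercolationContinuityZ3.Theorems

namespace Quant

open Finset

/-- the two-point law `{lo, hi; g}` (as in `…QuantLawDEC`) -/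
local notation3 "TP[" lo ", " hi ", " g ", " h "]" =>
  (g : ℝ) * (if (h : ℕ) = (hi : ℕ) then (1 : ℝ) else 0) + (1 - (g : ℝ)) * (if (h : ℕ) = (lo : ℕ) then (1 : ℝ) else 0)

namespace LawDec

/-! ### The far-dominant theorem -/

/-- **CONVOLUTION, FAR-DOMINANT LAYERS, NO HEAVINESS.**  `0 < y < 1`; `μ₁`, `μ₂` probability laws on `{0..M₁}`, `{0..M₂}` (means `T₁`, `T₂`),
top-affordable (`y·Mᵢ ≤ Tᵢ`), DEC(j′) at every layer `j′ < Mᵢ` (ANY data); `4j < 2T₂ + T₁`.  Then `y ≤ Σ_{j < h ≤ M₁+M₂} lconv μ₁ μ₂ h`. [this work] -/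
theorem lconv_tail_ge_farDominant (y T₁ T₂ : ℝ) (j M₁ M₂ : ℕ) (μ₁ μ₂ : ℕ → ℝ) (hy0 : 0 < y) (hy1 : y < 1)
    (h10 : ∀ h, 0 ≤ μ₁ h) (h1M : ∀ h, M₁ < h → μ₁ h = 0) (h11 : ∑ h ∈ Finset.range (M₁ + 1), μ₁ h = 1)
    (hT₁ : ∑ h ∈ Finset.range (M₁ + 1), (h : ℝ) * μ₁ h = T₁) (hta1 : y * (M₁ : ℝ) ≤ T₁)
    (hdec1 : ∀ j', j' < M₁ → DECAt y j' M₁ μ₁)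
    (h20 : ∀ h, 0 ≤ μ₂ h) (h2M : ∀ h, M₂ < h → μ₂ h = 0) (h21 : ∑ h ∈ Finset.range (M₂ + 1), μ₂ h = 1)
    (hT₂ : ∑ h ∈ Finset.range (M₂ + 1), (h : ℝ) * μ₂ h = T₂) (hta2 : y * (M₂ : ℝ) ≤ T₂)
    (hdec2 : ∀ j', j' < M₂ → DECAt y j' M₂ μ₂) (hdom : 4 * (j : ℝ) < 2 * T₂ + T₁) :
    y ≤ ∑ h ∈ Finset.Ico (j + 1) (M₁ + M₂ + 1), lconv M₁ M₂ μ₁ μ₂ h := by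
  classical
  -- a datum of `μ₂` at layer `j` (Theorem A above the top)
  have hdecj : DECAt y j M₂ μ₂ := by
    by_cases hjM : j < M₂
    · exact hdec2 j hjM
    · refine decAt_of_top_le M₂ μ₂ h20 h2M h21 y hy1 (fun h hh => ?_) j (not_lt.1 hjM)
      have hhM : h ≤ M₂ := by
        by_contra hc
        exact (lt_irrefl (0 : ℝ)) (lt_of_lt_of_eq hh (h2M h (not_le.1 hc)))
      rw [hT₂]
      calc y * (h : ℝ) ≤ y * (M₂ : ℝ) := mul_le_mul_of_nonneg_left (by exact_mod_cast hhM) hy0.le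
        _ ≤ T₂ := hta2
  rw [decAt_iff_decAtT, hT₂] at hdecj
  obtain ⟨ρ, hρ, lam, g, lo, hi, hl0, hl1, hg, hlohi, hhi, hμ₂, hval⟩ := hdecj
  -- the tail over the datum (as in `lconv_tail_ge_of_hdecAtT`)
  have hrow : ∀ i ∈ Finset.range (M₁ + 1),
      ∑ k ∈ Finset.range (M₂ + 1), (if j + 1 ≤ i + k then μ₁ i * μ₂ k else 0)
        = ∑ r, lam r * (μ₁ i * (g r * (if j + 1 ≤ i + hi r then (1 : ℝ) else 0)
            + (1 - g r) * (if j + 1 ≤ i + lo r then (1 : ℝ) else 0))) := by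
    intro i _
    calc ∑ k ∈ Finset.range (M₂ + 1), (if j + 1 ≤ i + k then μ₁ i * μ₂ k else 0)
        = ∑ k ∈ Finset.range (M₂ + 1), ∑ r, (if j + 1 ≤ i + k then (μ₁ i * lam r) * TP[lo r, hi r, g r, k] else 0) := by
          refine Finset.sum_congr rfl fun k _ => ?_
          by_cases hjk : j + 1 ≤ i + k
          · simp only [if_pos hjk]
            rw [hμ₂ k, Finset.mul_sum]
            exact Finset.sum_congr rfl fun r _ => by ring
          · simp only [if_neg hjk, Finset.sum_const_zero]
      _ = ∑ r, ∑ k ∈ Finset.range (M₂ + 1), (if j + 1 ≤ i + k then (μ₁ i * lam r) * TP[lo r, hi r, g r, k] else 0) :=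
          Finset.sum_comm
      _ = ∑ r, (μ₁ i * lam r) * ∑ k ∈ Finset.range (M₂ + 1), (if j + 1 ≤ i + k then TP[lo r, hi r, g r, k] else 0) := by
          refine Finset.sum_congr rfl fun r _ => ?_
          rw [Finset.mul_sum]
          refine Finset.sum_congr rfl fun k _ => ?_
          split_ifs <;> ring
      _ = _ := by
          refine Finset.sum_congr rfl fun r _ => ?_
          rw [sum_ite_TP M₂ j i (lo r) (hi r) (g r) ((hlohi r).trans (hhi r)) (hhi r)]
          ring
  have htail : ∑ h ∈ Finset.Ico (j + 1) (M₁ + M₂ + 1), lconv M₁ M₂ μ₁ μ₂ h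
      = ∑ r, lam r * (g r * (∑ i ∈ Finset.range (M₁ + 1), μ₁ i * (if j + 1 ≤ i + hi r then (1 : ℝ) else 0))
          + (1 - g r) * (∑ i ∈ Finset.range (M₁ + 1), μ₁ i * (if j + 1 ≤ i + lo r then (1 : ℝ) else 0))) := by
    rw [conv_tail_eq, Finset.sum_congr rfl hrow, Finset.sum_comm]
    refine Finset.sum_congr rfl fun r _ => ?_
    rw [← Finset.mul_sum]
    congr 1
    rw [Finset.mul_sum, Finset.mul_sum, ← Finset.sum_add_distrib]
    exact Finset.sum_congr rfl fun i _ => by ring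
  -- the giant mass and the deep mass of `μ₂` over the datum
  set up : ρ → ℝ := fun r => g r * (if j + 1 ≤ hi r then (1 : ℝ) else 0) + (1 - g r) * (if j + 1 ≤ lo r then (1 : ℝ) else 0)
    with hup
  set dl : ρ → ℝ := fun r => (1 - g r) * (if lo r ≤ j ∧ (lo r : ℝ) + j < T₂ then (1 : ℝ) else 0)
    + g r * (if hi r ≤ j ∧ (hi r : ℝ) + j < T₂ then (1 : ℝ) else 0) with hdl
  have hUP : ∑ r, lam r * up r = ∑ h ∈ Finset.range (M₂ + 1), (if j + 1 ≤ h then μ₂ h else 0) := by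
    symm
    calc ∑ h ∈ Finset.range (M₂ + 1), (if j + 1 ≤ h then μ₂ h else 0)
        = ∑ h ∈ Finset.range (M₂ + 1), ∑ r, lam r * (if j + 1 ≤ h then TP[lo r, hi r, g r, h] else 0) := by
          refine Finset.sum_congr rfl fun h _ => ?_
          by_cases hh : j + 1 ≤ h
          · simp only [if_pos hh]; exact hμ₂ h
          · simp only [if_neg hh, mul_zero, Finset.sum_const_zero]
      _ = ∑ r, lam r * ∑ h ∈ Finset.range (M₂ + 1), (if j + 1 ≤ h then TP[lo r, hi r, g r, h] else 0) := by
          rw [Finset.sum_comm]; exact Finset.sum_congr rfl fun r _ => by rw [Finset.mul_sum]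
      _ = ∑ r, lam r * up r := by
          refine Finset.sum_congr rfl fun r _ => ?_
          congr 1
          have := sum_ite_TP M₂ j 0 (lo r) (hi r) (g r) ((hlohi r).trans (hhi r)) (hhi r)
          simp only [Nat.zero_add] at this
          rw [this]
  have hDL : ∑ r, lam r * dl r = ∑ h ∈ Finset.range (M₂ + 1), (if h ≤ j ∧ (h : ℝ) + j < T₂ then μ₂ h else 0) := by
    symm
    calc ∑ h ∈ Finset.range (M₂ + 1), (if h ≤ j ∧ (h : ℝ) + j < T₂ then μ₂ h else 0)
        = ∑ h ∈ Finset.range (M₂ + 1), ∑ r, lam r * (if h ≤ j ∧ (h : ℝ) + j < T₂ then TP[lo r, hi r, g r, h] else 0) := by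
          refine Finset.sum_congr rfl fun h _ => ?_
          by_cases hh : h ≤ j ∧ (h : ℝ) + j < T₂
          · simp only [if_pos hh]; exact hμ₂ h
          · simp only [if_neg hh, mul_zero, Finset.sum_const_zero]
      _ = ∑ r, lam r * ∑ h ∈ Finset.range (M₂ + 1), (if h ≤ j ∧ (h : ℝ) + j < T₂ then TP[lo r, hi r, g r, h] else 0) := by
          rw [Finset.sum_comm]; exact Finset.sum_congr rfl fun r _ => by rw [Finset.mul_sum]
      _ = ∑ r, lam r * dl r := by
          refine Finset.sum_congr rfl fun r _ => ?_
          congr 1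
          -- split the component into its two atoms
          have e : ∀ h, (if h ≤ j ∧ (h : ℝ) + j < T₂ then TP[lo r, hi r, g r, h] else 0)
              = (if h = hi r then g r * (if hi r ≤ j ∧ (hi r : ℝ) + j < T₂ then (1 : ℝ) else 0) else 0)
                + (if h = lo r then (1 - g r) * (if lo r ≤ j ∧ (lo r : ℝ) + j < T₂ then (1 : ℝ) else 0) else 0) := by
            intro h
            have e1 : (if h ≤ j ∧ (h : ℝ) + j < T₂ then g r * (if h = hi r then (1 : ℝ) else 0) else 0)
                = (if h = hi r then g r * (if hi r ≤ j ∧ (hi r : ℝ) + j < T₂ then (1 : ℝ) else 0) else 0) := by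
              by_cases hk : h = hi r
              · subst hk; simp only [if_true]; split_ifs <;> ring
              · simp only [hk, if_false]; split_ifs <;> ring
            have e2 : (if h ≤ j ∧ (h : ℝ) + j < T₂ then (1 - g r) * (if h = lo r then (1 : ℝ) else 0) else 0)
                = (if h = lo r then (1 - g r) * (if lo r ≤ j ∧ (lo r : ℝ) + j < T₂ then (1 : ℝ) else 0) else 0) := by
              by_cases hk : h = lo r
              · subst hk; simp only [if_true]; split_ifs <;> ring
              · simp only [hk, if_false]; split_ifs <;> ring
            rw [← e1, ← e2]
            split_ifs <;> ring
          rw [Finset.sum_congr rfl (fun h _ => e h), Finset.sum_add_distrib,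
            Finset.sum_ite_eq' (Finset.range (M₂ + 1)) (hi r), if_pos (Finset.mem_range.2 (by have := hhi r; omega)),
            Finset.sum_ite_eq' (Finset.range (M₂ + 1)) (lo r),
            if_pos (Finset.mem_range.2 (by have := (hlohi r).trans (hhi r); omega))]
          simp only [hdl]; ring
  -- `deepLows` for `μ₂` at the layer `j`
  have hgb2 := deepLows_le_giants_pred y T₂ M₂ j μ₂ hy0 hy1 h20 h2M h21 hT₂ hta2 hdec2
  rw [← hUP, ← hDL] at hgb2
  -- sum of the per-component budgets
  have hbud : ∀ r, 0 < lam r → (1 - y) * up r - y * dl r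
      ≤ g r * (∑ i ∈ Finset.range (M₁ + 1), μ₁ i * (if j + 1 ≤ i + hi r then (1 : ℝ) else 0))
        + (1 - g r) * (∑ i ∈ Finset.range (M₁ + 1), μ₁ i * (if j + 1 ≤ i + lo r then (1 : ℝ) else 0)) - y :=
    fun r hr => piece_budget y T₁ T₂ j M₁ (lo r) (hi r) (g r) μ₁ hy0 hy1 h10 h1M h11 hT₁ hta1 hdec1 (hg r) (hlohi r) (hval r hr) hdom
  rw [htail]
  have hsum : ∑ r, lam r * ((1 - y) * up r - y * dl r)
      ≤ ∑ r, lam r * (g r * (∑ i ∈ Finset.range (M₁ + 1), μ₁ i * (if j + 1 ≤ i + hi r then (1 : ℝ) else 0))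
        + (1 - g r) * (∑ i ∈ Finset.range (M₁ + 1), μ₁ i * (if j + 1 ≤ i + lo r then (1 : ℝ) else 0)) - y) := by
    refine Finset.sum_le_sum fun r _ => ?_
    rcases (hl0 r).eq_or_lt with hz | hpos
    · rw [← hz, zero_mul, zero_mul]
    · exact mul_le_mul_of_nonneg_left (hbud r hpos) (hl0 r)
  have e1 : ∑ r, lam r * ((1 - y) * up r - y * dl r) = (1 - y) * ∑ r, lam r * up r - y * ∑ r, lam r * dl r := by
    rw [Finset.mul_sum, Finset.mul_sum, ← Finset.sum_sub_distrib]
    exact Finset.sum_congr rfl fun r _ => by ring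
  have e2 : ∑ r, lam r * (g r * (∑ i ∈ Finset.range (M₁ + 1), μ₁ i * (if j + 1 ≤ i + hi r then (1 : ℝ) else 0))
        + (1 - g r) * (∑ i ∈ Finset.range (M₁ + 1), μ₁ i * (if j + 1 ≤ i + lo r then (1 : ℝ) else 0)) - y)
      = (∑ r, lam r * (g r * (∑ i ∈ Finset.range (M₁ + 1), μ₁ i * (if j + 1 ≤ i + hi r then (1 : ℝ) else 0))
        + (1 - g r) * (∑ i ∈ Finset.range (M₁ + 1), μ₁ i * (if j + 1 ≤ i + lo r then (1 : ℝ) else 0)))) - y := by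
    have hy : ∑ r, lam r * y = y := by rw [← Finset.sum_mul, hl1, one_mul]
    conv_rhs => rw [← hy]
    rw [← Finset.sum_sub_distrib]
    exact Finset.sum_congr rfl fun r _ => by ring
  rw [e1, e2] at hsum
  linarith

/-- **DEC AT A FAR-DOMINANT LAYER** (`4j < 2T₂ + T₁`): the convolution of two top-affordable probability laws DEC at every layer below their tops is
`DECAt y j (M₁ + M₂)`. [this work] -/
theorem lconv_decAt_farDominant_right (y T₁ T₂ : ℝ) (j M₁ M₂ : ℕ) (μ₁ μ₂ : ℕ → ℝ) (hy0 : 0 < y) (hy1 : y < 1)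
    (h10 : ∀ h, 0 ≤ μ₁ h) (h1M : ∀ h, M₁ < h → μ₁ h = 0) (h11 : ∑ h ∈ Finset.range (M₁ + 1), μ₁ h = 1)
    (hT₁ : ∑ h ∈ Finset.range (M₁ + 1), (h : ℝ) * μ₁ h = T₁) (hta1 : y * (M₁ : ℝ) ≤ T₁)
    (hdec1 : ∀ j', j' < M₁ → DECAt y j' M₁ μ₁)
    (h20 : ∀ h, 0 ≤ μ₂ h) (h2M : ∀ h, M₂ < h → μ₂ h = 0) (h21 : ∑ h ∈ Finset.range (M₂ + 1), μ₂ h = 1)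
    (hT₂ : ∑ h ∈ Finset.range (M₂ + 1), (h : ℝ) * μ₂ h = T₂) (hta2 : y * (M₂ : ℝ) ≤ T₂)
    (hdec2 : ∀ j', j' < M₂ → DECAt y j' M₂ μ₂) (hdom : 4 * (j : ℝ) < 2 * T₂ + T₁) :
    DECAt y j (M₁ + M₂) (lconv M₁ M₂ μ₁ μ₂) :=
  decAt_of_tail_ge (M₁ + M₂) (lconv M₁ M₂ μ₁ μ₂) (lconv_nonneg M₁ M₂ μ₁ μ₂ h10 h20)
    (fun h hh => lconv_eq_zero M₁ M₂ μ₁ μ₂ h hh) (sum_lconv M₁ M₂ μ₁ μ₂ h11 h21) y j hy0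
    (lconv_tail_ge_farDominant y T₁ T₂ j M₁ M₂ μ₁ μ₂ hy0 hy1 h10 h1M h11 hT₁ hta1 hdec1 h20 h2M h21 hT₂ hta2 hdec2 hdom)

/-- **TWO LAWS DEC AT EVERY LAYER HAVE A CONVOLUTION DEC AT EVERY FAR-DOMINANT LAYER** (`4j < 2T₂ + T₁` or `4j < 2T₁ + T₂`, i.e.
`2j < T₁ + T₂ − min(T₁,T₂)/2`): no heaviness assumption on either factor. [this work] -/
theorem lconv_decAt_farDominant (y T₁ T₂ : ℝ) (j M₁ M₂ : ℕ) (μ₁ μ₂ : ℕ → ℝ) (hy0 : 0 < y) (hy1 : y < 1)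
    (h10 : ∀ h, 0 ≤ μ₁ h) (h1M : ∀ h, M₁ < h → μ₁ h = 0) (h11 : ∑ h ∈ Finset.range (M₁ + 1), μ₁ h = 1)
    (hT₁ : ∑ h ∈ Finset.range (M₁ + 1), (h : ℝ) * μ₁ h = T₁) (hta1 : y * (M₁ : ℝ) ≤ T₁)
    (hdec1 : ∀ j', j' < M₁ → DECAt y j' M₁ μ₁)
    (h20 : ∀ h, 0 ≤ μ₂ h) (h2M : ∀ h, M₂ < h → μ₂ h = 0) (h21 : ∑ h ∈ Finset.range (M₂ + 1), μ₂ h = 1)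
    (hT₂ : ∑ h ∈ Finset.range (M₂ + 1), (h : ℝ) * μ₂ h = T₂) (hta2 : y * (M₂ : ℝ) ≤ T₂)
    (hdec2 : ∀ j', j' < M₂ → DECAt y j' M₂ μ₂)
    (hdom : 4 * (j : ℝ) < 2 * T₂ + T₁ ∨ 4 * (j : ℝ) < 2 * T₁ + T₂) :
    DECAt y j (M₁ + M₂) (lconv M₁ M₂ μ₁ μ₂) := by
  rcases hdom with hd | hd
  · exact lconv_decAt_farDominant_right y T₁ T₂ j M₁ M₂ μ₁ μ₂ hy0 hy1 h10 h1M h11 hT₁ hta1 hdec1 h20 h2M h21 hT₂ hta2 hdec2 hd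
  · rw [lconv_comm, Nat.add_comm]
    exact lconv_decAt_farDominant_right y T₂ T₁ j M₂ M₁ μ₂ μ₁ hy0 hy1 h20 h2M h21 hT₂ hta2 hdec2 h10 h1M h11 hT₁ hta1 hdec1 hd

end LawDec

end Quant

end Summit.CriticalPhenomena.PercolationContinuityZ3.Theorems
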